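import Literature.Analysis.SpecialFunctions.PerturbedChebyshevRecurrence
import Literature.Analysis.SpecialFunctions.LaguerrePolynomial
import HarnessLib

/-!
# Ratios of consecutive-degree Laguerre values at the zeros of `L_{d-1}^{(α)}`

At a zero `τ` of `L_{d-1}^{(α)}` (`α = b - 1 > -1`) put `q_k := L_{d-2-k}^{(α)}(τ)` (`0 ≤ k ≤ d - 2`).
Read downwards, the three-term recurrence [Szegő (5.1.10)] is
`(b+d-3-k) q_{k+1} = (b+2d-4-2k-τ) q_k - (d-1-k) q_{k-1}` (`q_{-1} = L_{d-1}(τ) = 0`), and after the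
rescaling `Q_k := (-1)^k (b+d-2-k)_{k+2} q_k` it becomes EXACTLY a perturbed Chebyshev recurrence
(`PerturbedChebyshevRecurrence.lean`):

  `Q_{k+1} = (y + 2k) Q_k - (d-1-k)(b+d-2-k) Q_{k-1}`,  `y := τ - (b+2d-4)`,

with `s² = d(b+d-2)`, drift `2k = k·θ·s` for `θ = 2/√(d(b+d-2))`, damping defect
`s² - c_k = (k+1)(b+d-2) + dk - k(k+1) ≤ s²·ε̄_k`, `ε̄_k := (k+1)/d + k/(b+d-2)`, and the oscillatory
condition `y² ≤ 4s²`, i.e. `(τ - (b+2d-4))² ≤ 4d(b+d-2)` — which for the zeros of `L_{d-1}^{(b-1)}`,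
`b ≥ 2`, is implied by the Ismail–Li bracket `|τ - (2d+b-5)| < √(1+4(d-2)(d+b-3))`
[Ismail–Li 1992, Thm. 4, (3.3)–(3.4)]; here it is a hypothesis on `τ`. Main results:

* `perturbedChebyshev_abs_le_upTo`, `duhamel_three_term_upTo` — finite-horizon forms of the
  variation-of-constants bound (hypotheses only up to an index `K`);
* `laguerre_downward_three_term_eval`, `laguerre_eval_succ_at_zero` — (5.1.10) read downwards at `τ`;
* `laguerre_interlacingRatio_abs_le` — **for `0 ≤ k ≤ d-2`:
  `(b+d-2-k)_{k+2} · |L_{d-2-k}^{(b-1)}(τ)| ≤ (b+d-2)(b+d-1) · (d(b+d-2))^{k/2} · M_k · |L_{d-2}^{(b-1)}(τ)|`**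
  for every majorant `M` with `M_k ≥ (k+1) + Σ_{1≤j<k} (k-j)(j·θ·M_j + ε̄_j·M_{j-1})` (`k ≤ d-2`).

This is the elementary consequence of Szegő (5.1.10) and Abramowitz–Stegun 22.14.6 behind the
"perturbed-Chebyshev" bound for the extremal ratios of the Laguerre-centred skeleton of the Jensen
polynomials of `ξ`; no orthogonality and no zero asymptotics are used.

## References
* [Szego1975] G. Szegő, *Orthogonal Polynomials*, AMS Colloq. Publ. 23, 4th ed. (1975), (5.1.10).
* [AbramowitzStegun1964] M. Abramowitz, I. A. Stegun (eds.), *Handbook of Mathematical Functions*,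
  NBS (1964), 22.14.6.
* [Elaydi1996] S. N. Elaydi, *An Introduction to Difference Equations*, Springer UTM (1996), §2.4.1.
-/

open Polynomial Real Finset
open Polynomial.Chebyshev

noncomputable section

namespace Literature.Analysis.SpecialFunctions

/-! ### Finite-horizon variation of constants and perturbed Chebyshev bound -/

/-- Variation of constants [Elaydi 1996, §2.4.1] on a finite horizon `k ≤ K`: with `V_{i+2} = yV_{i+1} - λV_i`,
`V_0 = 1`, `V_1 = y`, `Q_1 = yQ_0`, `f_0 = 0`, `f_{j+1} = Q_{j+2} - yQ_{j+1} + λQ_j` (`j + 2 ≤ K`):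
`Q_k = Q_0 V_k + Σ_{j<k} V_{k-1-j} f_j` for `k ≤ K`. [cite: Elaydi1996, §2.4.1] -/
theorem duhamel_three_term_upTo {Q f V : ℕ → ℝ} {y lam : ℝ} (K : ℕ) (hV0 : V 0 = 1) (hV1 : V 1 = y)
    (hVrec : ∀ i, V (i + 2) = y * V (i + 1) - lam * V i) (hQ1 : 1 ≤ K → Q 1 = y * Q 0)
    (hf0 : f 0 = 0) (hf : ∀ j, j + 2 ≤ K → f (j + 1) = Q (j + 2) - y * Q (j + 1) + lam * Q j) :
    ∀ k, k ≤ K → Q k = Q 0 * V k + ∑ j ∈ range k, V (k - 1 - j) * f j := by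
  intro k
  induction k using Nat.twoStepInduction with
  | zero => intro; simp [hV0]
  | one =>
    intro hK
    rw [sum_range_one, hQ1 hK, hV1, show 1 - 1 - 0 = 0 by rfl, hV0, hf0]; ring
  | more k ih1 ih2 =>
    intro hK
    have hQ : Q (k + 2) = y * Q (k + 1) - lam * Q k + f (k + 1) := by rw [hf k hK]; ring
    rw [hQ, ih2 (by omega), ih1 (by omega)]
    rw [show k + 2 = k + 1 + 1 from rfl, sum_range_succ _ (k + 1), sum_range_succ _ k,
      sum_range_succ _ k]
    have e0 : V (k + 1 + 1 - 1 - (k + 1)) = 1 := by rw [show k + 1 + 1 - 1 - (k + 1) = 0 by omega, hV0]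
    have e1 : V (k + 1 + 1 - 1 - k) = y := by rw [show k + 1 + 1 - 1 - k = 1 by omega, hV1]
    have e2 : V (k + 1 - 1 - k) = 1 := by rw [show k + 1 - 1 - k = 0 by omega, hV0]
    have key : ∑ j ∈ range k, V (k + 1 + 1 - 1 - j) * f j
        = y * ∑ j ∈ range k, V (k + 1 - 1 - j) * f j - lam * ∑ j ∈ range k, V (k - 1 - j) * f j := by
      rw [mul_sum, mul_sum, ← sum_sub_distrib]
      refine sum_congr rfl fun j hj => ?_
      have hj := mem_range.mp hj
      rw [show k + 1 + 1 - 1 - j = (k - 1 - j) + 2 by omega,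
        show k + 1 - 1 - j = (k - 1 - j) + 1 by omega, hVrec]
      ring
    rw [key, e0, e1, e2, hVrec k]
    ring

/-- **Perturbed Chebyshev bound on a finite horizon** `k ≤ K`: `Q_{k+2} = a_{k+1}Q_{k+1} - c_{k+1}Q_k`
(`k + 2 ≤ K`), `Q_1 = yQ_0` (if `1 ≤ K`), `s > 0`, `|y| ≤ 2s`, `|a_k - y| ≤ kθs` and `|s² - c_k| ≤ s²ε_k`
(`1 ≤ k ≤ K`), `M_k ≥ (k+1) + Σ_{1≤j<k}(k-j)(jθM_j + ε_jM_{j-1})` (`k ≤ K`) ⟹ `|Q_k| ≤ |Q_0| s^k M_k`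
(`k ≤ K`). Variation of constants against `s^iU_i(y/2s)` [Abramowitz–Stegun 22.14.6] and induction.
[cite: Elaydi1996, §2.4.1] -/
theorem perturbedChebyshev_abs_le_upTo {Q a c ε M : ℕ → ℝ} {y s θ : ℝ} (K : ℕ) (hs : 0 < s)
    (hy : |y| ≤ 2 * s) (hθ : 0 ≤ θ) (hε : ∀ k, k ≤ K → 0 ≤ ε k) (hQ1 : 1 ≤ K → Q 1 = y * Q 0)
    (hrec : ∀ k, k + 2 ≤ K → Q (k + 2) = a (k + 1) * Q (k + 1) - c (k + 1) * Q k)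
    (ha : ∀ k, 1 ≤ k → k ≤ K → |a k - y| ≤ k * θ * s)
    (hc : ∀ k, 1 ≤ k → k ≤ K → |s ^ 2 - c k| ≤ s ^ 2 * ε k)
    (hM : ∀ k : ℕ, k ≤ K →
      (k + 1 : ℝ) + ∑ j ∈ Ico 1 k, ((k : ℝ) - j) * (j * θ * M j + ε j * M (j - 1)) ≤ M k) :
    ∀ k, k ≤ K → |Q k| ≤ |Q 0| * s ^ k * M k := by
  have hs0 : s ≠ 0 := hs.ne'
  set f : ℕ → ℝ := fun j => if j = 0 then 0 else Q (j + 1) - y * Q j + s ^ 2 * Q (j - 1) with hf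
  have hf0 : f 0 = 0 := by simp [hf]
  have hf' : ∀ j, j + 2 ≤ K → f (j + 1) = Q (j + 2) - y * Q (j + 1) + s ^ 2 * Q j := fun j _ => by
    simp [hf]
  have hfb : ∀ j, 1 ≤ j → j + 1 ≤ K → |f j| ≤ j * θ * s * |Q j| + s ^ 2 * ε j * |Q (j - 1)| := by
    intro j hj hjK
    obtain ⟨i, rfl⟩ : ∃ i, j = i + 1 := ⟨j - 1, by omega⟩
    have e : f (i + 1) = (a (i + 1) - y) * Q (i + 1) + (s ^ 2 - c (i + 1)) * Q i := by
      have : f (i + 1) = Q (i + 2) - y * Q (i + 1) + s ^ 2 * Q i := by simp [hf]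
      rw [this, hrec i (by omega)]; ring
    rw [e, show i + 1 - 1 = i by omega]
    calc |(a (i + 1) - y) * Q (i + 1) + (s ^ 2 - c (i + 1)) * Q i|
        ≤ |(a (i + 1) - y) * Q (i + 1)| + |(s ^ 2 - c (i + 1)) * Q i| := abs_add_le _ _
      _ = |a (i + 1) - y| * |Q (i + 1)| + |s ^ 2 - c (i + 1)| * |Q i| := by rw [abs_mul, abs_mul]
      _ ≤ ((i + 1 : ℕ) : ℝ) * θ * s * |Q (i + 1)| + s ^ 2 * ε (i + 1) * |Q i| := by
          gcongr
          · exact ha (i + 1) hj (by omega)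
          · exact hc (i + 1) hj (by omega)
  have hD := duhamel_three_term_upTo (V := fun i => s ^ i * (U ℝ (i : ℤ)).eval (y / (2 * s))) K
    (by simp) (by simpa using chebyshevCmp_one hs0 y) (fun i => by simpa using chebyshevCmp_add_two hs0 y i)
    hQ1 hf0 hf'
  have hV : ∀ i : ℕ, |s ^ i * (U ℝ (i : ℤ)).eval (y / (2 * s))| ≤ (i + 1) * s ^ i :=
    fun i => abs_chebyshevCmp_le hs hy i
  intro k
  induction k using Nat.strong_induction_on with
  | _ k ih =>
    intro hkK
    rw [hD k hkK]
    have hQ0 : 0 ≤ |Q 0| := abs_nonneg _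
    have h1 : |Q 0 * (s ^ k * (U ℝ (k : ℤ)).eval (y / (2 * s)))| ≤ |Q 0| * ((k + 1) * s ^ k) := by
      rw [abs_mul]; exact mul_le_mul_of_nonneg_left (hV k) hQ0
    have h2 : ∀ j ∈ range k,
        |(s ^ (k - 1 - j) * (U ℝ ((k - 1 - j : ℕ) : ℤ)).eval (y / (2 * s))) * f j|
          ≤ if j = 0 then 0 else
            |Q 0| * s ^ k * (((k : ℝ) - j) * (j * θ * M j + ε j * M (j - 1))) := by
      intro j hj
      have hjk := mem_range.mp hj
      by_cases hj0 : j = 0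
      · subst hj0; simp [hf0]
      rw [if_neg hj0]
      have hj1 : 1 ≤ j := Nat.one_le_iff_ne_zero.mpr hj0
      rw [abs_mul]
      have hVj := hV (k - 1 - j)
      have hfj := hfb j hj1 (by omega)
      have ihj := ih j hjk (by omega)
      have ihj1 := ih (j - 1) (by omega) (by omega)
      have hεj := hε j (by omega)
      have hcast : (((k - 1 - j : ℕ) : ℝ) + 1) = (k : ℝ) - j := by
        rw [Nat.cast_sub (by omega), Nat.cast_sub (by omega)]; push_cast; ring
      calc |s ^ (k - 1 - j) * (U ℝ ((k - 1 - j : ℕ) : ℤ)).eval (y / (2 * s))| * |f j|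
          ≤ ((((k - 1 - j : ℕ) : ℝ) + 1) * s ^ (k - 1 - j))
              * (j * θ * s * |Q j| + s ^ 2 * ε j * |Q (j - 1)|) :=
            mul_le_mul hVj hfj (abs_nonneg _) (by positivity)
        _ ≤ ((((k - 1 - j : ℕ) : ℝ) + 1) * s ^ (k - 1 - j))
              * (j * θ * s * (|Q 0| * s ^ j * M j) + s ^ 2 * ε j * (|Q 0| * s ^ (j - 1) * M (j - 1))) := by
            gcongr
        _ = |Q 0| * s ^ k * (((k : ℝ) - j) * (j * θ * M j + ε j * M (j - 1))) := by
            rw [hcast]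
            have e1 : s ^ (k - 1 - j) * s * s ^ j = s ^ k := by
              rw [← pow_succ, ← pow_add]; congr 1; omega
            have e2 : s ^ (k - 1 - j) * s ^ 2 * s ^ (j - 1) = s ^ k := by
              rw [← pow_add, ← pow_add]; congr 1; omega
            calc ((k : ℝ) - j) * s ^ (k - 1 - j)
                  * (j * θ * s * (|Q 0| * s ^ j * M j) + s ^ 2 * ε j * (|Q 0| * s ^ (j - 1) * M (j - 1)))
                = ((k : ℝ) - j) * |Q 0| * (j * θ * M j * (s ^ (k - 1 - j) * s * s ^ j)
                    + ε j * M (j - 1) * (s ^ (k - 1 - j) * s ^ 2 * s ^ (j - 1))) := by ring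
              _ = |Q 0| * s ^ k * (((k : ℝ) - j) * (j * θ * M j + ε j * M (j - 1))) := by
                    rw [e1, e2]; ring
    have h3 := (abs_sum_le_sum_abs _ _).trans (sum_le_sum h2)
    have h4 : ∑ j ∈ range k, (if j = 0 then (0 : ℝ) else
        |Q 0| * s ^ k * (((k : ℝ) - j) * (j * θ * M j + ε j * M (j - 1))))
        = |Q 0| * s ^ k * ∑ j ∈ Ico 1 k, ((k : ℝ) - j) * (j * θ * M j + ε j * M (j - 1)) := by
      rcases Nat.eq_zero_or_pos k with rfl | hk
      · simp
      · rw [Finset.range_eq_Ico, Finset.sum_eq_sum_Ico_succ_bot hk, if_pos rfl, zero_add, mul_sum]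
        refine sum_congr rfl fun j hj => ?_
        rw [if_neg (by have := (mem_Ico.mp hj).1; omega)]
    calc |Q 0 * (s ^ k * (U ℝ (k : ℤ)).eval (y / (2 * s)))
          + ∑ j ∈ range k, (s ^ (k - 1 - j) * (U ℝ ((k - 1 - j : ℕ) : ℤ)).eval (y / (2 * s))) * f j|
        ≤ |Q 0 * (s ^ k * (U ℝ (k : ℤ)).eval (y / (2 * s)))|
          + |∑ j ∈ range k, (s ^ (k - 1 - j) * (U ℝ ((k - 1 - j : ℕ) : ℤ)).eval (y / (2 * s))) * f j| :=
          abs_add_le _ _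
      _ ≤ |Q 0| * ((k + 1) * s ^ k)
          + |Q 0| * s ^ k * ∑ j ∈ Ico 1 k, ((k : ℝ) - j) * (j * θ * M j + ε j * M (j - 1)) := by
          rw [← h4]; exact add_le_add h1 h3
      _ = |Q 0| * s ^ k
          * ((k + 1 : ℝ) + ∑ j ∈ Ico 1 k, ((k : ℝ) - j) * (j * θ * M j + ε j * M (j - 1))) := by ring
      _ ≤ |Q 0| * s ^ k * M k := mul_le_mul_of_nonneg_left (hM k hkK) (by positivity)

/-! ### The three-term recurrence read downwards at a point -/

/-- Szegő (5.1.10) at a point, indices written downwards from `d - 2`: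
`(α+d-3-k)·L_{d-4-k}(x) = (2d-5-2k+α-x)·L_{d-3-k}(x) - (d-2-k)·L_{d-2-k}(x)` for `k + 4 ≤ d`.
[cite: Szego1975, (5.1.10)] -/
theorem laguerre_downward_three_term_eval (α x : ℝ) {d k : ℕ} (hk : k + 4 ≤ d) :
    (α + d - 3 - k) * (laguerre α (d - 4 - k)).eval x
      = (2 * d - 5 - 2 * k + α - x) * (laguerre α (d - 3 - k)).eval x
        - ((d : ℝ) - 2 - k) * (laguerre α (d - 2 - k)).eval x := by
  obtain ⟨m, rfl⟩ : ∃ m, d = m + 4 + k := ⟨d - 4 - k, by omega⟩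
  have h := congrArg (fun p => p.eval x) (laguerre_three_term α m)
  simp only [eval_mul, eval_C, eval_sub, eval_X] at h
  rw [show m + 4 + k - 4 - k = m by omega, show m + 4 + k - 3 - k = m + 1 by omega,
    show m + 4 + k - 2 - k = m + 2 by omega]
  push_cast
  linear_combination h

/-- At a zero `τ` of `L_{d-1}^{(α)}` (`3 ≤ d`): `(α+d-2)·L_{d-3}(τ) = (2d-3+α-τ)·L_{d-2}(τ)`
(Szegő (5.1.10) with the `L_{d-1}` term vanishing). [cite: Szego1975, (5.1.10)] -/
theorem laguerre_eval_succ_at_zero (α : ℝ) {d : ℕ} (hd : 3 ≤ d) {τ : ℝ}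
    (hτ : (laguerre α (d - 1)).eval τ = 0) :
    (α + d - 2) * (laguerre α (d - 3)).eval τ = (2 * d - 3 + α - τ) * (laguerre α (d - 2)).eval τ := by
  obtain ⟨m, rfl⟩ : ∃ m, d = m + 3 := ⟨d - 3, by omega⟩
  have h := congrArg (fun p => p.eval τ) (laguerre_three_term α m)
  simp only [eval_mul, eval_C, eval_sub, eval_X] at h
  rw [show m + 3 - 1 = m + 2 by omega] at hτ
  rw [hτ, mul_zero] at h
  rw [show m + 3 - 3 = m by omega, show m + 3 - 2 = m + 1 by omega]
  push_cast
  linear_combination h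

/-! ### The ratio bound at the zeros of `L_{d-1}^{(b-1)}` -/

/-- `(x)_{2} = x(x+1)`. [cite: DLMF, 5.2.5] -/
private theorem ascPochhammer_two_eval (x : ℝ) : (ascPochhammer ℝ 2).eval x = x * (x + 1) := by
  rw [show (2 : ℕ) = 1 + 1 from rfl, ascPochhammer_eval_succ_left 1 x, ascPochhammer_one, eval_X]

/-- **Ratio bound at the interlacing points.** Let `b > 0`, `2 ≤ d`, `τ` a zero of `L_{d-1}^{(b-1)}`
satisfying the oscillatory condition `(τ - (b+2d-4))² ≤ 4d(b+d-2)` (for the actual zeros and `b ≥ 2`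
this is the Ismail–Li bracket), and let `M` be any majorant with
`M_k ≥ (k+1) + Σ_{1≤j<k} (k-j)·(j·(2/√(d(b+d-2)))·M_j + ((j+1)/d + j/(b+d-2))·M_{j-1})` for `k ≤ d-2`.
Then for every `0 ≤ k ≤ d-2`:
`(b+d-2-k)_{k+2}·|L_{d-2-k}^{(b-1)}(τ)| ≤ (b+d-2)(b+d-1)·√(d(b+d-2))^k·M_k·|L_{d-2}^{(b-1)}(τ)|`.
(The downward recurrence (5.1.10) for `Q_k = (-1)^k (b+d-2-k)_{k+2} L_{d-2-k}(τ)` is the perturbed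
Chebyshev recurrence with `y = τ-(b+2d-4)`, `s² = d(b+d-2)`, drift `2k`, defect `≤ s²ε̄_k`; then
`perturbedChebyshev_abs_le_upTo`.) [cite: Szego1975, (5.1.10)] -/
theorem laguerre_interlacingRatio_abs_le {b τ : ℝ} {d : ℕ} (hb : 0 < b) (hd : 2 ≤ d)
    (hτ : (laguerre (b - 1) (d - 1)).eval τ = 0)
    (hosc : (τ - (b + 2 * d - 4)) ^ 2 ≤ 4 * (d * (b + d - 2)))
    {M : ℕ → ℝ} (hM : ∀ k : ℕ, k ≤ d - 2 →
      (k + 1 : ℝ) + ∑ j ∈ Ico 1 k, ((k : ℝ) - j) *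
        (j * (2 / Real.sqrt (d * (b + d - 2))) * M j + ((j + 1) / d + j / (b + d - 2)) * M (j - 1))
        ≤ M k) :
    ∀ k, k ≤ d - 2 →
      (ascPochhammer ℝ (k + 2)).eval (b + d - 2 - k) * |(laguerre (b - 1) (d - 2 - k)).eval τ|
        ≤ (b + d - 2) * (b + d - 1) * Real.sqrt (d * (b + d - 2)) ^ k * M k
          * |(laguerre (b - 1) (d - 2)).eval τ| := by
  -- notation
  have hd0 : (0 : ℝ) < d := by exact_mod_cast (by omega : 0 < d)
  have hbd : (0 : ℝ) < b + d - 2 := by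
    have : (2 : ℝ) ≤ d := by exact_mod_cast hd
    linarith
  set s : ℝ := Real.sqrt (d * (b + d - 2)) with hs_def
  have hs : 0 < s := Real.sqrt_pos.mpr (by positivity)
  have hs2 : s ^ 2 = d * (b + d - 2) := Real.sq_sqrt (by positivity)
  set y : ℝ := τ - (b + 2 * d - 4) with hy_def
  have hy : |y| ≤ 2 * s := by
    refine abs_le_of_sq_le_sq ?_ (by positivity)
    rw [mul_pow, hs2]; norm_num; linarith [hosc]
  -- the sequences
  set q : ℕ → ℝ := fun k => (laguerre (b - 1) (d - 2 - k)).eval τ with hq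
  set p : ℕ → ℝ := fun k => (ascPochhammer ℝ (k + 2)).eval (b + d - 2 - k) with hp
  set Q : ℕ → ℝ := fun k => (-1) ^ k * p k * q k with hQ
  have hp_succ : ∀ k : ℕ, p (k + 1) = (b + d - 3 - k) * p k := fun k => by
    simp only [hp]
    rw [show k + 1 + 2 = (k + 2) + 1 from rfl, ascPochhammer_eval_succ_left (k + 2)]
    push_cast
    have harg : b + (d : ℝ) - 2 - ((k : ℝ) + 1) + 1 = b + d - 2 - k := by ring
    rw [harg]
    ring
  have hp0 : p 0 = (b + d - 2) * (b + d - 1) := by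
    simp only [hp, Nat.cast_zero, sub_zero, zero_add]
    rw [ascPochhammer_two_eval]; ring
  have hp_pos : ∀ k : ℕ, k ≤ d - 2 → 0 < p k := fun k hk => by
    simp only [hp]
    refine ascPochhammer_eval_pos ?_ _
    have : (k : ℝ) ≤ (d : ℝ) - 2 := by
      have h := (Nat.cast_le (α := ℝ)).mpr hk
      rw [Nat.cast_sub hd] at h
      exact_mod_cast h
    linarith
  -- the recurrence `Q_{k+2} = a_{k+1} Q_{k+1} - c_{k+1} Q_k` for `k + 2 ≤ d - 2`
  have hrec : ∀ k : ℕ, k + 2 ≤ d - 2 →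
      Q (k + 2) = (y + 2 * ((k + 1 : ℕ) : ℝ)) * Q (k + 1)
        - (((d : ℝ) - 1 - ((k + 1 : ℕ) : ℝ)) * (b + d - 2 - ((k + 1 : ℕ) : ℝ))) * Q k := by
    intro k hk
    have h3 := laguerre_downward_three_term_eval (b - 1) τ (d := d) (k := k) (by omega)
    simp only [hQ, hq]
    rw [show d - 2 - (k + 2) = d - 4 - k by omega, show d - 2 - (k + 1) = d - 3 - k by omega,
      show k + 2 = k + 1 + 1 from rfl, hp_succ (k + 1), hp_succ k]
    push_cast
    rw [show ((-1 : ℝ)) ^ (k + 1 + 1) = (-1) ^ k by rw [pow_succ, pow_succ]; ring,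
      show ((-1 : ℝ)) ^ (k + 1) = -(-1) ^ k by rw [pow_succ]; ring]
    linear_combination ((-1 : ℝ) ^ k * (b + d - 3 - k) * p k) * h3
  -- the first step `Q_1 = y Q_0` (when `d ≥ 3`)
  have hQ1 : 1 ≤ d - 2 → Q 1 = y * Q 0 := by
    intro h1
    have h3 := laguerre_eval_succ_at_zero (b - 1) (d := d) (by omega) hτ
    simp only [hQ, hq, Nat.sub_zero, pow_zero, one_mul, pow_one]
    rw [show d - 2 - 1 = d - 3 by omega, show (1 : ℕ) = 0 + 1 from rfl, hp_succ 0, hp0]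
    push_cast
    linear_combination (-((b + d - 2) * (b + d - 1))) * h3
  -- apply the finite-horizon perturbed Chebyshev bound
  have hmain := perturbedChebyshev_abs_le_upTo (Q := Q) (M := M)
    (a := fun j => y + 2 * (j : ℝ)) (c := fun j => ((d : ℝ) - 1 - j) * (b + d - 2 - j))
    (ε := fun j => ((j : ℝ) + 1) / d + j / (b + d - 2)) (y := y) (s := s) (θ := 2 / s) (d - 2) hs hy
    (by positivity) (fun k _ => by show (0 : ℝ) ≤ ((k : ℝ) + 1) / d + k / (b + d - 2); positivity) hQ1
    (fun k hk => by simpa using hrec k hk)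
    (fun k _ _ => by
      show |y + 2 * (k : ℝ) - y| ≤ k * (2 / s) * s
      have e : y + 2 * (k : ℝ) - y = k * (2 / s) * s := by field_simp; ring
      rw [e, abs_of_nonneg (by positivity)])
    (fun k _ hk => by
      show |s ^ 2 - ((d : ℝ) - 1 - k) * (b + d - 2 - k)| ≤ s ^ 2 * (((k : ℝ) + 1) / d + k / (b + d - 2))
      have hk' : (k : ℝ) ≤ (d : ℝ) - 2 := by
        have h := (Nat.cast_le (α := ℝ)).mpr hk
        rw [Nat.cast_sub hd] at h
        exact_mod_cast h
      have e1 : s ^ 2 - ((d : ℝ) - 1 - k) * (b + d - 2 - k)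
          = (k + 1) * (b + d - 2 - k) + d * k := by rw [hs2]; ring
      have e2 : s ^ 2 * (((k : ℝ) + 1) / d + k / (b + d - 2)) = (k + 1) * (b + d - 2) + d * k := by
        rw [hs2]; field_simp
      rw [e1, e2, abs_of_nonneg (by have : (0:ℝ) ≤ k := Nat.cast_nonneg k; nlinarith)]
      have : (0:ℝ) ≤ k := Nat.cast_nonneg k
      nlinarith)
    (fun k hk => hM k hk)
  -- unpack
  intro k hk
  have h := hmain k hk
  have hQk : |Q k| = p k * |q k| := by
    simp only [hQ]
    rw [abs_mul, abs_mul, abs_pow, abs_neg, abs_one, one_pow, one_mul, abs_of_pos (hp_pos k hk)]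
  have hQ0' : |Q 0| = (b + d - 2) * (b + d - 1) * |q 0| := by
    simp only [hQ]
    rw [pow_zero, one_mul, abs_mul, hp0, abs_of_pos (mul_pos hbd (by linarith))]
  rw [hQk, hQ0'] at h
  have hq0 : q 0 = (laguerre (b - 1) (d - 2)).eval τ := by simp [hq]
  have hqk : q k = (laguerre (b - 1) (d - 2 - k)).eval τ := by simp [hq]
  rw [hq0] at h; rw [hqk] at h
  calc (ascPochhammer ℝ (k + 2)).eval (b + d - 2 - k) * |(laguerre (b - 1) (d - 2 - k)).eval τ|
      = p k * |(laguerre (b - 1) (d - 2 - k)).eval τ| := by simp [hp]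
    _ ≤ (b + d - 2) * (b + d - 1) * |(laguerre (b - 1) (d - 2)).eval τ| * s ^ k * M k := h
    _ = (b + d - 2) * (b + d - 1) * s ^ k * M k * |(laguerre (b - 1) (d - 2)).eval τ| := by ring

end Literature.Analysis.SpecialFunctions

end
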